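import Mathlib
import Literature.Computability.AlgebraicComplexity.ApolarityAction
import Literature.Computability.AlgebraicComplexity.PaddedPermanentPartials
import Summits.ValiantsHypothesis.ValiantsHypothesis.Theorems.ValuativeGCTValuativeFlipPencilTransferPrelims

/-!
# Four-row pencil transfer `m → m + 1` — core transfer theorem (wall-breaker axis k8, crux `ValuativeFlip`)

Support for line `four-row-count` of crux `ValuativeGCT.ValuativeFlip`
(stmt-ValiantsHypothesis-12624), stub `stub_fourRowPencilRank`: the four-row tangent span of
`g · (ℓ^p · P)` only depends on the size through the overall factor `ℓ^{p-1}`, so its rank does not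
drop under one more unit of padding.  This file proves the abstract transfer theorem over arbitrary
finite index types (`pt_transfer_aux`, `pt_transfer`); the matrix-space instantiation is
`ValuativeGCTValuativeFlipPencilTransfer.lean`.  No definitions are introduced.
-/

set_option linter.dupNamespace false

namespace Summit.ValiantsHypothesis.ValiantsHypothesis.Theorems.ValuativeFlip

open MvPolynomial
open scoped BigOperators Matrix
open Literature.Computability.AlgebraicComplexity

noncomputable section

/-! ## The transfer theorem (abstract core) -/

/-- **Core of the transfer `m → m + 1`.**  Let `j : σ ↪ τ` carry the kept set `K` into `K'`, let
`ρ, ρ'` be compatible algebra maps (`ρ' ∘ rename j = rename j ∘ ρ`), and let the padded forms be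
`X ℓ ^ p · P` on `σ` and `X ℓ' ^ (p+1) · rename j P` on `τ` with `P = rename φ P₀` free of `ℓ'`
after renaming.  If `g' ∈ GL_τ` transports `g ∈ GL_σ` on `P`, the kept part `B = ρ'(g' · X ℓ')` of
the new padding form is nonzero, and either `B` is the transported old padding form (with `p ≥ 1`)
or the old kept padding form is absent (`p = 0`) or vanishes, then multiplication by `B` after
renaming embeds the old four-row tangent span into the new one, so the rank does not drop.
[this crux, line four-row-count; folklore linear algebra] -/
theorem pt_transfer_aux {σ τ : Type*} [Fintype σ] [DecidableEq σ] [Fintype τ] [DecidableEq τ]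
    {K : σ → Prop} {K' : τ → Prop} (j : σ → τ) (hj : Function.Injective j)
    (hK : ∀ i, K i → K' (j i))
    (ρ : MvPolynomial σ ℂ →ₐ[ℂ] MvPolynomial σ ℂ) (ρ' : MvPolynomial τ ℂ →ₐ[ℂ] MvPolynomial τ ℂ)
    (hρ : ∀ f, ρ' (rename j f) = rename j (ρ f))
    {α : Type*} (φ : α → σ) (P₀ : MvPolynomial α ℂ) (ℓ : σ) (ℓ' : τ) (p : ℕ)
    (hφ : ∀ x, j (φ x) ≠ ℓ')
    (g : GL σ ℂ) (g' : GL τ ℂ)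
    (hQ : linSubst τ ℂ (g' : Matrix τ τ ℂ) (rename j (rename φ P₀)) =
      rename j (linSubst σ ℂ (g : Matrix σ σ ℂ) (rename φ P₀)))
    (hB : ρ' (linSubst τ ℂ (g' : Matrix τ τ ℂ) (X ℓ')) ≠ 0)
    (hBL : (ρ' (linSubst τ ℂ (g' : Matrix τ τ ℂ) (X ℓ')) =
        rename j (ρ (linSubst σ ℂ (g : Matrix σ σ ℂ) (X ℓ))) ∧ 0 < p) ∨
      p = 0 ∨ ρ (linSubst σ ℂ (g : Matrix σ σ ℂ) (X ℓ)) = 0) :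
    Module.finrank ℂ ↥(Submodule.span ℂ (Set.range fun ab : {a : σ // K a} × σ =>
        X ab.1.1 * ρ (pderiv ab.2 (linSubst σ ℂ (g : Matrix σ σ ℂ) (X ℓ ^ p * rename φ P₀))))) ≤
    Module.finrank ℂ ↥(Submodule.span ℂ (Set.range fun ab : {a : τ // K' a} × τ =>
        X ab.1.1 * ρ' (pderiv ab.2 (linSubst τ ℂ (g' : Matrix τ τ ℂ)
          (X ℓ' ^ (p + 1) * rename j (rename φ P₀)))))) := by
  classical
  -- abbreviations
  set Λ : MvPolynomial σ ℂ := linSubst σ ℂ (g : Matrix σ σ ℂ) (X ℓ) with hΛ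
  set Q : MvPolynomial σ ℂ := linSubst σ ℂ (g : Matrix σ σ ℂ) (rename φ P₀) with hQdef
  set ν : MvPolynomial τ ℂ := linSubst τ ℂ (g' : Matrix τ τ ℂ) (X ℓ') with hν
  set B : MvPolynomial τ ℂ := ρ' ν with hBdef
  set L : MvPolynomial τ ℂ := rename j (ρ Λ) with hLdef
  set S' := Submodule.span ℂ (Set.range fun ab : {a : τ // K' a} × τ =>
        X ab.1.1 * ρ' (pderiv ab.2 (linSubst τ ℂ (g' : Matrix τ τ ℂ)
          (X ℓ' ^ (p + 1) * rename j (rename φ P₀))))) with hS'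
  set S := Submodule.span ℂ (Set.range fun ab : {a : σ // K a} × σ =>
        X ab.1.1 * ρ (pderiv ab.2 (linSubst σ ℂ (g : Matrix σ σ ℂ) (X ℓ ^ p * rename φ P₀)))) with hS
  have hF : linSubst σ ℂ (g : Matrix σ σ ℂ) (X ℓ ^ p * rename φ P₀) = Λ ^ p * Q := by
    rw [map_mul, map_pow]
  have hG : linSubst τ ℂ (g' : Matrix τ τ ℂ) (X ℓ' ^ (p + 1) * rename j (rename φ P₀)) =
      ν ^ (p + 1) * rename j Q := by
    rw [map_mul, map_pow, hQ]
  have hdΛ : ∀ b, pderiv b Λ = C ((g : Matrix σ σ ℂ) b ℓ) := fun b => pt_pderiv_linSubst_X _ b ℓ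
  have hdν : ∀ b, pderiv b ν = C ((g' : Matrix τ τ ℂ) b ℓ') := fun b => pt_pderiv_linSubst_X _ b ℓ'
  have hdP' : pderiv ℓ' (rename j (rename φ P₀)) = 0 := by
    rw [rename_rename]
    exact pderiv_rename_eq_zero_of_forall_ne (fun x => hφ x) _
  have hρQ : ρ' (rename j Q) = rename j (ρ Q) := hρ Q
  have hρdQ : ∀ b, ρ' (pderiv (j b) (rename j Q)) = rename j (ρ (pderiv b Q)) := fun b => by
    rw [pderiv_rename hj, hρ]
  -- (i) the pure padding products lie in `S'`
  have hi : ∀ a' : {a : τ // K' a}, X a'.1 * (B ^ p * rename j (ρ Q)) ∈ S' := by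
    intro a'
    have h : X a'.1 * ρ' (linSubst τ ℂ (g' : Matrix τ τ ℂ)
        (pderiv ℓ' (X ℓ' ^ (p + 1) * rename j (rename φ P₀)))) ∈ S' :=
      pt_X_mul_linSubst_pderiv_mem_span (K := K') ρ'.toLinearMap g'
        (X ℓ' ^ (p + 1) * rename j (rename φ P₀)) a' ℓ'
    have hd : pderiv ℓ' (X ℓ' ^ (p + 1) * rename j (rename φ P₀)) =
        ((p + 1 : ℕ) : MvPolynomial τ ℂ) * X ℓ' ^ p * rename j (rename φ P₀) := by
      rw [pderiv_mul, hdP', mul_zero, add_zero, pderiv_pow, pderiv_X_self, mul_one,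
        Nat.add_sub_cancel]
    have hcalc : X a'.1 * ρ' (linSubst τ ℂ (g' : Matrix τ τ ℂ)
        (pderiv ℓ' (X ℓ' ^ (p + 1) * rename j (rename φ P₀)))) =
        ((p + 1 : ℕ) : ℂ) • (X a'.1 * (B ^ p * rename j (ρ Q))) := by
      rw [hd]
      simp only [map_mul, map_pow, map_natCast, hQ, ← hν, ← hBdef, hρQ]
      rw [MvPolynomial.smul_eq_C_mul, C_eq_coe_nat]
      ring
    rw [hcalc] at h
    have hne : ((p + 1 : ℕ) : ℂ) ≠ 0 := Nat.cast_ne_zero.mpr (Nat.succ_ne_zero p)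
    have h2 := S'.smul_mem (((p + 1 : ℕ) : ℂ)⁻¹) h
    rwa [smul_smul, inv_mul_cancel₀ hne, one_smul] at h2
  -- (iii) the products with derivatives of the inner factor lie in `S'`
  have hiii : ∀ (a' : {a : τ // K' a}) (b : σ),
      X a'.1 * (B ^ (p + 1) * rename j (ρ (pderiv b Q))) ∈ S' := by
    intro a' b
    have hgen : X a'.1 * ρ' (pderiv (j b) (linSubst τ ℂ (g' : Matrix τ τ ℂ)
        (X ℓ' ^ (p + 1) * rename j (rename φ P₀)))) ∈ S' :=
      Submodule.subset_span ⟨(a', j b), rfl⟩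
    have hcalc : X a'.1 * ρ' (pderiv (j b) (linSubst τ ℂ (g' : Matrix τ τ ℂ)
        (X ℓ' ^ (p + 1) * rename j (rename φ P₀)))) =
        (((p + 1 : ℕ) : ℂ) * (g' : Matrix τ τ ℂ) (j b) ℓ') • (X a'.1 * (B ^ p * rename j (ρ Q))) +
          X a'.1 * (B ^ (p + 1) * rename j (ρ (pderiv b Q))) := by
      rw [hG, pderiv_mul, pderiv_pow, hdν, Nat.add_sub_cancel]
      simp only [map_add, map_mul, map_pow, map_natCast, MvPolynomial.algHom_C,
        MvPolynomial.algebraMap_eq, ← hBdef, hρQ, hρdQ]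
      rw [MvPolynomial.smul_eq_C_mul, C_mul, C_eq_coe_nat]
      ring
    rw [hcalc] at hgen
    have h2 := S'.sub_mem hgen (S'.smul_mem (((p + 1 : ℕ) : ℂ) * (g' : Matrix τ τ ℂ) (j b) ℓ') (hi a'))
    rwa [add_sub_cancel_left] at h2
  -- the embedding `Φ = (B * ·) ∘ rename j`
  let Φ : MvPolynomial σ ℂ →ₗ[ℂ] MvPolynomial τ ℂ :=
    (LinearMap.mulLeft ℂ B) ∘ₗ (rename j : MvPolynomial σ ℂ →ₐ[ℂ] MvPolynomial τ ℂ).toLinearMap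
  have hΦapply : ∀ f, Φ f = B * rename j f := fun f => rfl
  have hΦ : Function.Injective Φ := by
    intro f₁ f₂ h
    rw [hΦapply, hΦapply] at h
    exact rename_injective j hj (mul_right_injective₀ hB h)
  have hle : S.map Φ ≤ S' := by
    rw [Submodule.map_le_iff_le_comap, hS, Submodule.span_le]
    rintro _ ⟨⟨a, b⟩, rfl⟩
    have haK : K' (j a.1) := hK a.1 a.2
    have himg : Φ (X a.1 * ρ (pderiv b (linSubst σ ℂ (g : Matrix σ σ ℂ) (X ℓ ^ p * rename φ P₀)))) =
        B * (X (j a.1) * ((p : MvPolynomial τ ℂ) * L ^ (p - 1) * C ((g : Matrix σ σ ℂ) b ℓ) *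
          rename j (ρ Q) + L ^ p * rename j (ρ (pderiv b Q)))) := by
      rw [hΦapply, hF, pderiv_mul, pderiv_pow, hdΛ]
      simp only [map_add, map_mul, map_pow, map_natCast, MvPolynomial.algHom_C,
        MvPolynomial.algebraMap_eq, rename_X, ← hLdef]
    rw [SetLike.mem_coe, Submodule.mem_comap, himg]
    rcases hBL with ⟨hBL', hp⟩ | hp0 | hL0
    · -- nondegenerate: `B = L`, `p = q + 1`
      obtain ⟨q, rfl⟩ : ∃ q, p = q + 1 := ⟨p - 1, by omega⟩
      have hBL2 : L = B := hBL'.symm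
      rw [Nat.add_sub_cancel, hBL2]
      have key : B * (X (j a.1) * (((q + 1 : ℕ) : MvPolynomial τ ℂ) * B ^ q *
            C ((g : Matrix σ σ ℂ) b ℓ) * rename j (ρ Q) + B ^ (q + 1) * rename j (ρ (pderiv b Q)))) =
          (((q + 1 : ℕ) : ℂ) * (g : Matrix σ σ ℂ) b ℓ) • (X (j a.1) * (B ^ (q + 1) * rename j (ρ Q))) +
            X (j a.1) * (B ^ (q + 1 + 1) * rename j (ρ (pderiv b Q))) := by
        rw [MvPolynomial.smul_eq_C_mul, C_mul, C_eq_coe_nat]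
        ring
      rw [show ((q + 1 : ℕ) : MvPolynomial τ ℂ) = (((q + 1 : ℕ) : ℕ) : MvPolynomial τ ℂ) from rfl] at key
      rw [show (↑(q + 1) : MvPolynomial τ ℂ) = ((q + 1 : ℕ) : MvPolynomial τ ℂ) from rfl, key]
      exact S'.add_mem (S'.smul_mem _ (hi ⟨j a.1, haK⟩)) (hiii ⟨j a.1, haK⟩ b)
    · -- bottom size: `p = 0`
      subst hp0
      have key : B * (X (j a.1) * (((0 : ℕ) : MvPolynomial τ ℂ) * L ^ (0 - 1) *
            C ((g : Matrix σ σ ℂ) b ℓ) * rename j (ρ Q) + L ^ 0 * rename j (ρ (pderiv b Q)))) =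
          X (j a.1) * (B ^ (0 + 1) * rename j (ρ (pderiv b Q))) := by
        push_cast
        ring
      rw [key]
      exact hiii ⟨j a.1, haK⟩ b
    · -- degenerate: the kept part of the old padding form vanishes
      have hL : L = 0 := by rw [hLdef, hL0, map_zero]
      rw [hL]
      rcases p with _ | _ | q
      · have key : B * (X (j a.1) * (((0 : ℕ) : MvPolynomial τ ℂ) * (0 : MvPolynomial τ ℂ) ^ (0 - 1) *
              C ((g : Matrix σ σ ℂ) b ℓ) * rename j (ρ Q) +
              (0 : MvPolynomial τ ℂ) ^ 0 * rename j (ρ (pderiv b Q)))) =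
            X (j a.1) * (B ^ (0 + 1) * rename j (ρ (pderiv b Q))) := by
          push_cast
          ring
        rw [key]
        exact hiii ⟨j a.1, haK⟩ b
      · have key : B * (X (j a.1) * (((0 + 1 : ℕ) : MvPolynomial τ ℂ) *
              (0 : MvPolynomial τ ℂ) ^ (0 + 1 - 1) * C ((g : Matrix σ σ ℂ) b ℓ) * rename j (ρ Q) +
              (0 : MvPolynomial τ ℂ) ^ (0 + 1) * rename j (ρ (pderiv b Q)))) =
            ((g : Matrix σ σ ℂ) b ℓ) • (X (j a.1) * (B ^ (0 + 1) * rename j (ρ Q))) := by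
          rw [MvPolynomial.smul_eq_C_mul]
          push_cast
          ring
        rw [key]
        exact S'.smul_mem _ (hi ⟨j a.1, haK⟩)
      · have key : B * (X (j a.1) * (((q + 1 + 1 : ℕ) : MvPolynomial τ ℂ) *
              (0 : MvPolynomial τ ℂ) ^ (q + 1 + 1 - 1) * C ((g : Matrix σ σ ℂ) b ℓ) * rename j (ρ Q) +
              (0 : MvPolynomial τ ℂ) ^ (q + 1 + 1) * rename j (ρ (pderiv b Q)))) = 0 := by
          rw [Nat.add_sub_cancel, zero_pow (Nat.succ_ne_zero q), zero_pow (Nat.succ_ne_zero (q + 1))]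
          ring
        rw [key]
        exact S'.zero_mem
  haveI : FiniteDimensional ℂ S' := FiniteDimensional.span_of_finite ℂ (Set.finite_range _)
  calc Module.finrank ℂ S = Module.finrank ℂ ↥(S.map Φ) :=
        LinearEquiv.finrank_eq (Submodule.equivMapOfInjective Φ hΦ S)
    _ ≤ Module.finrank ℂ S' := Submodule.finrank_mono hle

/-! ## The transfer theorem -/

/-- **Transfer `m → m + 1` of the restricted tangent rank (abstract form).**  With the data of
`pt_transfer_aux` (`j` carrying `K` onto its image inside `K'`, `K'` with two elements, the new
padding variable `ℓ'` not kept and not a variable of the inner factor, and `j ℓ = ℓ'` exactly when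
there is old padding), for every `g ∈ GL_σ` there is `g' ∈ GL_τ` — the block extension of `g`,
followed if necessary by a transvection feeding a column with nonzero kept part into the padding
column — such that the rank of the restricted tangent span of `g' · (X ℓ' ^ (p+1) · rename j P)`
is at least that of `g · (X ℓ ^ p · P)`. [this crux, line four-row-count] -/
theorem pt_transfer {σ τ : Type*} [Fintype σ] [DecidableEq σ] [Fintype τ] [DecidableEq τ]
    (K : σ → Prop) [DecidablePred K] (K' : τ → Prop) [DecidablePred K']
    (j : σ → τ) (hj : Function.Injective j) (hK : ∀ i, K i ↔ K' (j i))
    (hK2 : ∃ a₁ a₂ : τ, K' a₁ ∧ K' a₂ ∧ a₁ ≠ a₂)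
    {α : Type*} (φ : α → σ) (P₀ : MvPolynomial α ℂ) (ℓ : σ) (ℓ' : τ) (p : ℕ)
    (hℓ' : ¬ K' ℓ') (hφ : ∀ x, j (φ x) ≠ ℓ')
    (hjℓ : 0 < p → j ℓ = ℓ') (hjℓ' : p = 0 → ∀ i, j i ≠ ℓ') (g : GL σ ℂ) :
    ∃ g' : GL τ ℂ,
      Module.finrank ℂ ↥(Submodule.span ℂ (Set.range fun ab : {a : σ // K a} × σ =>
        X ab.1.1 * aeval (fun i : σ => if K i then (X i : MvPolynomial σ ℂ) else 0)
          (pderiv ab.2 (linSubst σ ℂ (g : Matrix σ σ ℂ) (X ℓ ^ p * rename φ P₀))))) ≤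
      Module.finrank ℂ ↥(Submodule.span ℂ (Set.range fun ab : {a : τ // K' a} × τ =>
        X ab.1.1 * aeval (fun i : τ => if K' i then (X i : MvPolynomial τ ℂ) else 0)
          (pderiv ab.2 (linSubst τ ℂ (g' : Matrix τ τ ℂ)
            (X ℓ' ^ (p + 1) * rename j (rename φ P₀)))))) := by
  classical
  set ρ : MvPolynomial σ ℂ →ₐ[ℂ] MvPolynomial σ ℂ :=
    aeval (fun i : σ => if K i then (X i : MvPolynomial σ ℂ) else 0) with hρdef
  set ρ' : MvPolynomial τ ℂ →ₐ[ℂ] MvPolynomial τ ℂ :=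
    aeval (fun i : τ => if K' i then (X i : MvPolynomial τ ℂ) else 0) with hρ'def
  have hρ : ∀ f, ρ' (rename j f) = rename j (ρ f) := by
    have hc : ρ'.comp (rename j) = (rename j).comp ρ := by
      apply MvPolynomial.algHom_ext
      intro i
      simp only [AlgHom.comp_apply, rename_X, hρdef, hρ'def, aeval_X]
      by_cases hi : K i
      · rw [if_pos hi, if_pos ((hK i).mp hi), rename_X]
      · rw [if_neg hi, if_neg (fun h => hi ((hK i).mpr h)), map_zero]
    exact fun f => congrArg (fun F : MvPolynomial σ ℂ →ₐ[ℂ] MvPolynomial τ ℂ => F f) hc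
  have hρ'ℓ' : ρ' (X ℓ') = 0 := by rw [hρ'def, aeval_X, if_neg hℓ']
  obtain ⟨g₁, hg₁, hg₁'⟩ := pt_exists_blockExt j hj g
  have hg₁r : ∀ f, linSubst τ ℂ (g₁ : Matrix τ τ ℂ) (rename j f) =
      rename j (linSubst σ ℂ (g : Matrix σ σ ℂ) f) := pt_linSubst_rename_of_forall hg₁
  by_cases hcase : 0 < p ∧ ρ (linSubst σ ℂ (g : Matrix σ σ ℂ) (X ℓ)) ≠ 0
  · -- nondegenerate: the block extension itself
    have hν : ρ' (linSubst τ ℂ (g₁ : Matrix τ τ ℂ) (X ℓ')) =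
        rename j (ρ (linSubst σ ℂ (g : Matrix σ σ ℂ) (X ℓ))) := by
      rw [← hjℓ hcase.1, hg₁, hρ]
    refine ⟨g₁, pt_transfer_aux j hj (fun i hi => (hK i).mp hi) ρ ρ' hρ φ P₀ ℓ ℓ' p hφ g g₁
      (hg₁r _) ?_ (Or.inl ⟨hν, hcase.1⟩)⟩
    rw [hν]
    exact (map_ne_zero_iff _ (rename_injective j hj)).mpr hcase.2
  · -- degenerate (or bottom size): feed a column with nonzero kept part into the padding column
    obtain ⟨c, hcl, hc⟩ := pt_exists_col (K := K') hK2 g₁ ℓ'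
    obtain ⟨T, hT, hT'⟩ := pt_exists_transvection (τ := τ) c ℓ' hcl
    have hlam0 : ρ' (linSubst τ ℂ (g₁ : Matrix τ τ ℂ) (X ℓ')) = 0 := by
      rcases Nat.eq_zero_or_pos p with hp | hp
      · rw [hg₁' ℓ' (fun ⟨i, hi⟩ => hjℓ' hp i hi), hρ'ℓ']
      · have h0 : ρ (linSubst σ ℂ (g : Matrix σ σ ℂ) (X ℓ)) = 0 := by
          by_contra hne
          exact hcase ⟨hp, hne⟩
        rw [← hjℓ hp, hg₁, hρ, h0, map_zero]
    refine ⟨g₁ * T, pt_transfer_aux j hj (fun i hi => (hK i).mp hi) ρ ρ' hρ φ P₀ ℓ ℓ' p hφ g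
      (g₁ * T) ?_ ?_ (Or.inr ?_)⟩
    · rw [Units.val_mul, linSubst_mul, AlgHom.comp_apply, rename_rename,
        pt_linSubst_rename_of_fix _ (j ∘ φ) (fun x => hT _ (hφ x)), ← rename_rename, hg₁r]
    · rw [Units.val_mul, linSubst_mul, AlgHom.comp_apply, hT', map_add, map_add, hlam0, zero_add]
      exact hc
    · rcases Nat.eq_zero_or_pos p with hp | hp
      · exact Or.inl hp
      · right
        by_contra hne
        exact hcase ⟨hp, hne⟩

end

end Summit.ValiantsHypothesis.ValiantsHypothesis.Theorems.ValuativeFlip
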